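import Summits.CriticalPhenomena.PercolationContinuityZ3.Theorems.PercNearOneGluingNoHeavyQuantDepthOneRows
import HarnessLib

/-!
# QUANT lane R8, the GRADED-CLOSURE programme (lead g37 RULING V364), part 4: the DEPTH-1 single-gate closure is FALSE in the kernel
# (`LawDec.TLCGateConvClosed` typed and refuted: `LawDec.not_tlcGateConvClosed`, exact witness at `M = 14`)

builds on p205010 (kernel theorem, internal audit signed; external expert review pending)

Support file (`--supports stmt-CriticalPhenomena-4575`), QUANT lane seat prim-quant-census-2 (gen 64), rung R8 of
`run/shared/lean/prim/quant/LADDER.md`.  One `Prop` definition (the refuted node, `[status: refuted]`), two witness laws (`d1μ₁`, `d1μ₂`), theorems with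
standard axioms and default heartbeats, no sorries.  Parts 1–3: `…QuantDepthOneRows` (`LawDec.TLC`), `…QuantDepthOneClosure` (G₀ = `LawDec.TLCGateConvTLB`,
OPEN), `…QuantDepthTwoRows` (`LawDec.TLC2`).  Census memo: `run/shared/lean/prim/quant/prim-quant-census-2-g64/G0-CENSUS-G64.md` §4.

WHAT.  The light half (`y < 1/2`) of the tree-row programme has NO finite-depth invariant of depth ≤ 1: the two-layer bounds are not closed under gated
convolution (`not_tlbGateConvClosed`, `…QuantTLBClosure`, `M = 9..12`), their gate-stable form is not closed under plain convolution (lead g37 V361, exact),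
and — this file — the depth-≤1 family `LawDec.TLC` (all top-low-capacity rows, which contains the two-layer bounds) is not closed either.  The lead's first
depth-1 witness (V362, `M = 15`, margin `1.5·10⁻⁵`) suggested a marginal failure; census-2 g64's two-free-factor adversary shows the failure is ROBUST:
118 exact witnesses from `M = 14` on, floors `y ∈ [0.23, 0.47]`, margins up to `1/448`, all of the shape (gated relay) ⊗ (two or three lows + one mid + top,
top-affordability-tight).  The witness formalised here is the `M = 14` one at `y = 1/3` (margin `1/585`; see `not_tlcGateConvClosed`).  CONSEQUENCE for the
programme: closure must BUY depth — G₀ (`TLC ⟹ TLB`, unrefuted in 4.4 M exact LPs to `M₁ = 72`) and G₁ (`TLC ∧ TLC2 ⟹ TLC`, under test) are the graded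
statements; no same-depth statement survives.

PROOF SHAPE.  `d1μ₂`'s 39 TLC rows: threshold `0` carries no mass (generic nonnegativity, `usage_pos_of_compat`); thresholds `1` and `2` by `interval_cases`
on the layer and `norm_num` with the two mid usages `usage (1/3) (14/3) j 1 4 = 8`, `usage (1/3) (14/3) j 2 4 = 1/2` (`pairGate = 8/9`, `1/3`); the product
row `(11, 2)` by expanding `lconv` and the two product usages `1`, `1/2` on the mids `4`, `5`.  HONEST STATUS: a refutation of a candidate invariant; nothing
in the lane's RATE class log\* or honest sentence (`run/shared/lean/prim/quant/README.md`) changes.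

[this work]; the single-threshold rows and `usage`: prim-quant-census-2 g63 / prim-quant-stmt g22 (this lane); the refuted depth-0 node: prim-quant-lead g37.
Nothing here is cited as a published result.  The gluing rows served [cite: KozmaNitzan2024, Conjecture 3 (p. 15)]; product measure [cite: Grimmett1999, §1.3 p. 10].
-/

noncomputable section

namespace Summit.CriticalPhenomena.PercolationContinuityZ3.Theorems

namespace Quant

open Finset

namespace LawDec

/-- **THE DEPTH-1 SINGLE-GATE CLOSURE "D1" (typed here to be REFUTED below; lead g37 V362 / census-2 g63 §11 candidate 'D1-SGC').**  In the binder of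
`LawDec.SingleGateConvClosed` with DEC replaced by the depth-≤1 family on BOTH sides: floor `0 < y < 1`, one gate `0 < q ≤ 1`, probability laws `μ₁`, `μ₂`
on `{0..M₁}`, `{0..M₂}` whose gated versions are top-affordable at `y` and satisfy all top-low-capacity rows `LawDec.TLC y (q·Tᵢ) Mᵢ (gate μᵢ q)` (which
contain the two-layer bounds, `twoLayerRow_of_tlc`) ⟹ the gated convolution satisfies `LawDec.TLC`.  FALSE: `not_tlcGateConvClosed`.  (The statement with
`TLB` of the product as conclusion instead is the node G₀ `LawDec.TLCGateConvTLB` of `…QuantDepthOneClosure`, unrefuted.) [this work] [status: refuted] -/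
def TLCGateConvClosed : Prop :=
  ∀ (y q : ℝ) (M₁ M₂ : ℕ) (μ₁ μ₂ : ℕ → ℝ),
    0 < y → y < 1 → 0 < q → q ≤ 1 →
    (∀ h, 0 ≤ μ₁ h) → (∀ h, M₁ < h → μ₁ h = 0) → (∑ h ∈ Finset.range (M₁ + 1), μ₁ h = 1) →
    y * (M₁ : ℝ) ≤ q * ∑ h ∈ Finset.range (M₁ + 1), (h : ℝ) * μ₁ h →
    (∀ h, 0 ≤ μ₂ h) → (∀ h, M₂ < h → μ₂ h = 0) → (∑ h ∈ Finset.range (M₂ + 1), μ₂ h = 1) →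
    y * (M₂ : ℝ) ≤ q * ∑ h ∈ Finset.range (M₂ + 1), (h : ℝ) * μ₂ h →
    TLC y (q * ∑ h ∈ Finset.range (M₁ + 1), (h : ℝ) * μ₁ h) M₁ (gate μ₁ q) →
    TLC y (q * ∑ h ∈ Finset.range (M₂ + 1), (h : ℝ) * μ₂ h) M₂ (gate μ₂ q) →
    TLC y (q * ((∑ h ∈ Finset.range (M₁ + 1), (h : ℝ) * μ₁ h) + ∑ h ∈ Finset.range (M₂ + 1), (h : ℝ) * μ₂ h))
      (M₁ + M₂) (gate (lconv M₁ M₂ μ₁ μ₂) q)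

/-- the mid `4` for the low `1` at `(x, T) = (1/3, 14/3)`: usage `8` (`pairGate = 8/9`). [this work] -/
theorem d1wit_usage_low1_mid4 (j : ℕ) (hj : 4 ≤ j) : usage (1 / 3 : ℝ) (14 / 3) j 1 4 = 8 := by
  have hpg : pairGate (1 / 3 : ℝ) (14 / 3) 1 4 = 8 / 9 := by
    unfold pairGate; push_cast; rw [max_eq_left (by norm_num)]; norm_num
  unfold usage gateOf; rw [if_neg (by omega), hpg]; norm_num

/-- the mid `4` for the low `2` at `(1/3, 14/3)`: usage `1/2` (`pairGate = 1/3 = x`). [this work] -/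
theorem d1wit_usage_low2_mid4 (j : ℕ) (hj : 4 ≤ j) : usage (1 / 3 : ℝ) (14 / 3) j 2 4 = 1 / 2 := by
  have hpg : pairGate (1 / 3 : ℝ) (14 / 3) 2 4 = 1 / 3 := by
    unfold pairGate; push_cast; rw [max_eq_left (by norm_num)]; norm_num
  unfold usage gateOf; rw [if_neg (by omega), hpg]; norm_num

/-- the (empty) mid `3` for the low `2` at `(1/3, 14/3)`: usage `2` (its mass is `0`; the value only closes the arithmetic). [this work] -/
theorem d1wit_usage_low2_mid3 (j : ℕ) (hj : 3 ≤ j) : usage (1 / 3 : ℝ) (14 / 3) j 2 3 = 2 := by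
  have hpg : pairGate (1 / 3 : ℝ) (14 / 3) 2 3 = 2 / 3 := by
    unfold pairGate; push_cast; rw [max_eq_left (by norm_num)]; norm_num
  unfold usage gateOf; rw [if_neg (by omega), hpg]; norm_num

/-- product mid `4` at `(1/3, 5)`, layer `11`, low `2`: usage `1` (`pairGate = 1/2`). [this work] -/
theorem d1wit_prod_usage_mid4 : usage (1 / 3 : ℝ) 5 11 2 4 = 1 := by
  have hpg : pairGate (1 / 3 : ℝ) 5 2 4 = 1 / 2 := by
    unfold pairGate; push_cast; rw [max_eq_left (by norm_num)]; norm_num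
  unfold usage gateOf; rw [if_neg (by omega), hpg]; norm_num

/-- product mid `5` at `(1/3, 5)`, layer `11`, low `2`: usage `1/2` (`pairGate = 1/3`). [this work] -/
theorem d1wit_prod_usage_mid5 : usage (1 / 3 : ℝ) 5 11 2 5 = 1 / 2 := by
  have hpg : pairGate (1 / 3 : ℝ) 5 2 5 = 1 / 3 := by
    unfold pairGate; push_cast; rw [max_eq_left (by norm_num)]; norm_num
  unfold usage gateOf; rw [if_neg (by omega), hpg]; norm_num

/-- the relay factor of the depth-1 witness: `{0: 2/3, 1: 1/3}` (`= gate δ₁ (1/3)`, a tree law). [this work] -/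
def d1μ₁ (h : ℕ) : ℝ := if h = 0 then 2 / 3 else if h = 1 then 1 / 3 else 0

/-- the big factor of the depth-1 witness: `{1: 20/39, 2: 2/13, 4: 16/195, 14: 49/195}` (mean `14/3`, TLB- and TLC-clean, not DEC at layer 13). [this work] -/
def d1μ₂ (h : ℕ) : ℝ := if h = 1 then 20 / 39 else if h = 2 then 2 / 13 else if h = 4 then 16 / 195 else if h = 14 then 49 / 195 else 0

/-- `d1μ₂ ≥ 0`. [this work] -/
theorem d1μ₂_nonneg (h : ℕ) : 0 ≤ d1μ₂ h := by
  simp only [d1μ₂]; split_ifs <;> norm_num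

/-- the TLC rows of `d1μ₂` with threshold `i′ = 1` (tight at `j = 13`). [this work] -/
theorem tlc_d1μ₂_rows1 (j : ℕ) (hj : j < 14) (hi' : 1 ≤ j) :
    (1 / 3 : ℝ) / (1 - 1 / 3) * ∑ l ∈ Finset.range (1 + 1), d1μ₂ l
      ≤ ∑ h ∈ Finset.range (14 + 1), (if j + 1 ≤ h then d1μ₂ h else 0)
        + (1 / 3 : ℝ) / (1 - 1 / 3) * ∑ h ∈ Finset.range (14 + 1),
            (if h ≤ j ∧ (14 / 3 : ℝ) < ((1 : ℕ) : ℝ) + h then d1μ₂ h / usage (1 / 3) (14 / 3) j 1 h else 0) := by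
  interval_cases j <;> norm_num [Finset.sum_range_succ, d1μ₂, d1wit_usage_low1_mid4]

/-- the TLC rows of `d1μ₂` with threshold `i′ = 2` (tight at `j = 13`). [this work] -/
theorem tlc_d1μ₂_rows2 (j : ℕ) (hj : j < 14) (hi' : 2 ≤ j) :
    (1 / 3 : ℝ) / (1 - 1 / 3) * ∑ l ∈ Finset.range (2 + 1), d1μ₂ l
      ≤ ∑ h ∈ Finset.range (14 + 1), (if j + 1 ≤ h then d1μ₂ h else 0)
        + (1 / 3 : ℝ) / (1 - 1 / 3) * ∑ h ∈ Finset.range (14 + 1),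
            (if h ≤ j ∧ (14 / 3 : ℝ) < ((2 : ℕ) : ℝ) + h then d1μ₂ h / usage (1 / 3) (14 / 3) j 2 h else 0) := by
  interval_cases j <;> norm_num [Finset.sum_range_succ, d1μ₂, d1wit_usage_low2_mid4, d1wit_usage_low2_mid3]

/-- **THE DEPTH-1 CLOSURE IS FALSE** (census-2 g64; found by the two-free-factor alternating adversary, kit j214626, one of 118 exact witnesses; verified
by three independent evaluations).  Witness: `q = 1`, `y = 1/3` (`u = 1/2`), `μ₁ = d1μ₁ = {0: 2/3, 1: 1/3}` (a gated relay, mean `1/3`, top-affordable with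
equality), `μ₂ = d1μ₂ = {1: 20/39, 2: 2/13, 4: 16/195, 14: 49/195}` (mean `14/3 = y·14`, top-affordable with equality; every TLC row holds — with EQUALITY at
`(j, i′) = (13, 1)` and `(13, 2)`: usage of the mid `4` is `8` for the low `1` and `1/2` for the low `2` — but `μ₂` is not DEC at layer `13`); the convolution
`{1: 40/117, 2: 32/117, 3: 2/39, 4: 32/585, 5: 16/585, 14: 98/585, 15: 49/585}` (target `5`) violates the row `(j, i′) = (11, 2)`:
`u·ν{≤ 2} = 4/13 = 180/585` against `ν{≥ 12} + u·(ν(4)/1 + ν(5)/(1/2)) = 147/585 + 32/585 = 179/585` — short by `1/585`. [this work] -/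
theorem not_tlcGateConvClosed : ¬ TLCGateConvClosed := by
  intro H
  have n1 : ∀ h, 0 ≤ d1μ₁ h := by intro h; simp only [d1μ₁]; split_ifs <;> norm_num
  have z1 : ∀ h, 1 < h → d1μ₁ h = 0 := by intro h hh; simp only [d1μ₁]; rw [if_neg (by omega), if_neg (by omega)]
  have s1 : ∑ h ∈ Finset.range (1 + 1), d1μ₁ h = 1 := by simp only [d1μ₁, Finset.sum_range_succ, Finset.sum_range_zero]; norm_num
  have m1 : ∑ h ∈ Finset.range (1 + 1), (h : ℝ) * d1μ₁ h = 1 / 3 := by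
    simp only [d1μ₁, Finset.sum_range_succ, Finset.sum_range_zero]; norm_num
  have z2 : ∀ h, 14 < h → d1μ₂ h = 0 := by
    intro h hh; simp only [d1μ₂]; rw [if_neg (by omega), if_neg (by omega), if_neg (by omega), if_neg (by omega)]
  have s2 : ∑ h ∈ Finset.range (14 + 1), d1μ₂ h = 1 := by simp only [d1μ₂, Finset.sum_range_succ, Finset.sum_range_zero]; norm_num
  have m2 : ∑ h ∈ Finset.range (14 + 1), (h : ℝ) * d1μ₂ h = 14 / 3 := by
    simp only [d1μ₂, Finset.sum_range_succ, Finset.sum_range_zero]; norm_num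
  have t1 : (1 / 3 : ℝ) * ((1 : ℕ) : ℝ) ≤ 1 * ∑ h ∈ Finset.range (1 + 1), (h : ℝ) * d1μ₁ h := by rw [m1]; norm_num
  have t2 : (1 / 3 : ℝ) * ((14 : ℕ) : ℝ) ≤ 1 * ∑ h ∈ Finset.range (14 + 1), (h : ℝ) * d1μ₂ h := by rw [m2]; norm_num
  have c1 : TLC (1 / 3) (1 * ∑ h ∈ Finset.range (1 + 1), (h : ℝ) * d1μ₁ h) 1 (gate d1μ₁ 1) := by
    rw [m1, one_mul, gate_one]
    intro j i' hj hi' hlow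
    have hj0 : j = 0 := by omega
    have hi0 : i' = 0 := by omega
    subst hj0; subst hi0
    simp only [d1μ₁, Finset.sum_range_succ, Finset.sum_range_zero]
    norm_num
  have c2 : TLC (1 / 3) (1 * ∑ h ∈ Finset.range (14 + 1), (h : ℝ) * d1μ₂ h) 14 (gate d1μ₂ 1) := by
    rw [m2, one_mul, gate_one]
    intro j i' hj hi' hlow
    have hi2 : i' ≤ 2 := by
      by_contra hne
      have : (3 : ℝ) ≤ i' := by exact_mod_cast (by omega : 3 ≤ i')
      linarith
    rcases Nat.lt_or_ge i' 1 with h0 | h1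
    · -- threshold 0: no mass at 0, the right side is nonnegative
      have hi0 : i' = 0 := by omega
      subst hi0
      have hL : ∑ l ∈ Finset.range (0 + 1), d1μ₂ l = 0 := by simp [d1μ₂]
      rw [hL, mul_zero]
      refine add_nonneg (Finset.sum_nonneg fun h _ => ?_) (mul_nonneg (by norm_num) (Finset.sum_nonneg fun h _ => ?_))
      · split_ifs
        · exact d1μ₂_nonneg h
        · exact le_rfl
      · split_ifs with hc
        · have hh0 : 0 < h := by
            rcases hc with ⟨_, hc2⟩
            have : (0 : ℝ) < h := by push_cast at hc2; linarith
            exact_mod_cast this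
          exact div_nonneg (d1μ₂_nonneg h)
            (usage_pos_of_compat (1 / 3) (14 / 3) j 0 h (by norm_num) (by norm_num) (by norm_num) hh0 (Or.inr hc.2)).le
        · exact le_rfl
    · rcases Nat.lt_or_ge i' 2 with h1' | h2
      · have hi1 : i' = 1 := by omega
        subst hi1
        exact tlc_d1μ₂_rows1 j hj hi'
      · have hi2' : i' = 2 := by omega
        subst hi2'
        exact tlc_d1μ₂_rows2 j hj hi'
  have P := H (1 / 3) 1 1 14 d1μ₁ d1μ₂ (by norm_num) (by norm_num) one_pos le_rfl n1 z1 s1 t1 d1μ₂_nonneg z2 s2 t2 c1 c2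
  rw [m1, m2, one_mul, gate_one] at P
  have P112 := P 11 2 (by norm_num) (by norm_num) (by norm_num)
  simp only [lconv, d1μ₁, d1μ₂, Finset.sum_range_succ, Finset.sum_range_zero] at P112
  norm_num [d1wit_prod_usage_mid4, d1wit_prod_usage_mid5] at P112

end LawDec

end Quant

end Summit.CriticalPhenomena.PercolationContinuityZ3.Theorems
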